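/-
Copyright (c) 2026 the pub-hodgecm-mathlib formalisation cell (harness21).  Prover seat hodgecm-mathlib-F0P2-p07 (g0), strike line L1
`stub_firstTermThetaPairing` (LEAD F0P6-plan (g14), BATCH #56∕#59: «ramified `hmid` + (C3-κ) = F0P2-p07»): Track B «K2-LIT», hLiu418 = stmt-HodgeConjecture-24832,
road `K2_Liu`, socket #42S, organ S1 ROAD W, the RAMIFIED middle-cell row: `Ad(d_a)` ON THE LETTERS OF `P_Δ = M_Δ · N_Δ` (the `hg`∕`hd₁` reduction).
-/
import Summits.HodgeConjecture.HodgeConjecture.Theorems.K2LiuLocalSWRamifiedRelativeSign  -- ★ F7r: `blkB∕blkD_matA_localCongr_dA` (+ ★ F5′-A `adapt_matA_localCongr_dA`, `blkA∕blkC_…`, `isSiegelDelta_localCongr_dA_iff`)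
import Summits.HodgeConjecture.HodgeConjecture.Theorems.K2LiuSiegelDeltaLeviUnipotent      -- ★ (R-g): `exists_levi_mul_nElem`, `skew_inv_blkA_mul_blkB` (+ GR `nElem`, `adapt_matA_nElem`)
import Summits.HodgeConjecture.HodgeConjecture.Theorems.K2LiuSkewPairingNondegeneracy      -- ★ `smul_skew` (an `F_v`-multiple of a skew matrix is skew)
import HarnessLib

/-!
# Crux `HLiu418`, #42S organ S1, ROAD W, the RAMIFIED middle-cell row: `Ad(d_a)` ON THE LETTERS OF `P_Δ = M_Δ · N_Δ`

Cell `hodgecm-mathlib`, crux item hLiu418 = `stmt-HodgeConjecture-24832`; squad K2 ∕ K2Liu; LEAD F0P6-plan (g14), (M2a) chain lead K2Liu-p01 (g10);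
prover F0P2-p07 (g0).  THEOREMS ONLY (no `def`, no instance, no notation, no named-fact hypothesis, no `sorry`); lane `--supports stmt-HodgeConjecture-24832 --as helper`.

WHY.  The ramified S1 face ★ `K2LiuLocalSWSpanningRamifiedOfMpMoverMiddleRow.localDegPS_le_sup_localSWImage_of_mpMoverMiddleRow` (p862306) is proved modulo ONE
row `hmid` whose conclusion is the DILATION ROW `hd₁ : ∀ x ∈ P_Δ, F_Φ(w₁ · Ad_{d_a} x) = F_Φ(w₁ · x)`; ★ `K2LiuLocalSWRamifiedMiddleRowOfFactorisation` reduces it to a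
FACTORISATION ROW `hfac : F_Φ(w₁·x) = K·g(x)` (the (M2a) chain's (C3) Levi step, K2Liu-p01, ★ (M2b) `factorisation_of_middleProfile_balls`) plus `hg : g(Ad_{d_a} x) = g(x)`
on `P_Δ`.  The (C3) letters of `g` are functions of the ADAPTED BLOCKS of `x` — `A = blkA`, `B = blkB`, `D = blkD` (`C = 0` on `P_Δ`), the unipotent coordinate
`t_x = A⁻¹B`, the Levi part `m_x` — so `hg` (and `hd₁` directly) rests on how `Ad(d_a)` moves these letters.  ★ F5′-A `adapt_matA_localCongr_dA` gives
`adapt (matA (Ad_{d_a} x)) = [[A, a_v⁻¹B], [a_v C, D]]`; THIS FILE spells out the consequences the ramified row consumes (generic `F ⊂ E`, `c`, any `n`, any `T₀`):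
* §1 (over ★ F7r `blkB_matA_localCongr_dA` `B ↦ a_v⁻¹•B`, `blkD_matA_localCongr_dA` `D ↦ D`) `inv_blkA_mul_blkB_localCongr_dA` (`t_x ↦ a_v⁻¹•t_x`),
  `blkB_mul_inv_blkD_localCongr_dA` (`B D⁻¹ ↦ a_v⁻¹•(B D⁻¹)`);
* §2 `localCongr_dA_eq_self_of_blkB_eq_zero` — `Ad(d_a)` FIXES every Levi-type element (`B = C = 0`);
* §3 `localCongr_dA_nElem` — `Ad(d_a) n(t) = n(a_v⁻¹•t)` (skewness of `a_v⁻¹•t`: ★ `K2LiuSkewPairingNondegeneracy.smul_skew`);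
* §4 `localCongr_dA_levi_mul_nElem`, `localCongr_dA_nElem_mul_levi` — `Ad(d_a)(m·n(t)) = m·n(a_v⁻¹•t)` and the mirror order;
* §5 **`flip_mul_localCongr_dA_eq_of_unipScaling`** — the `hd₁` row follows from the UNIT-SCALING INVARIANCE of the middle profile in the unipotent letter:
  «`F₀(w₁ · m · n(a_v⁻¹•t)) = F₀(w₁ · m · n(t))` for every Levi-type `m ∈ P_Δ` and skew `t`» (★ (R-g) `exists_levi_mul_nElem`: `x = m_x · n(A⁻¹B)`), and
  **`levi_letters_localCongr_dA`** — any function of `(blkA, blkD)` alone is `Ad(d_a)`-invariant (the Levi letters of `g`: `c(x)`, the radii `ρ_x, ρ′_x`, the balls);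
* §6 `forall_le_imp_comp_mul_iff` — for a valuation `v` and a unit-valued `u` (`v u = 1`), «`P(u·z)` for all `v z ≤ r`» ⟺ «`P z` for all `v z ≤ r`» (the unipotent
  letter of `g` enters only through «`Ψ_x` trivial on a ball», and `Ψ_{Ad x}(z) = Ψ_x(a_v⁻¹ z)` with `|a|_{w₀} = 1` — the ramified socket's `ha₁`).
References: [Kudla1994] §2–§3 (the Siegel parabolic of the doubled space, Thm. 3.1); [HarrisKudlaSweet1996] §1 (1.9)–(1.11), (1.15); [MoeglinVignerasWaldspurger1987]
Chap. 1 I.17 (similitudes), Chap. 2 II.1 (`ψ ↦ ψ_a`), II.6; [PlatonovRapinchuk1994] §2.3; [Weil1964] n° 32.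
HONEST LABEL.  Count-neutral helper: `HC_CM` is proved only modulo the 7 printed citations (2 remaining named inputs: hLiu418 = `stmt-HodgeConjecture-24832`,
h413 = `stmt-HodgeConjecture-24833`) until rung 0 closes.  NOT here: the factorisation row itself ((C3), K2Liu-p01), the `hg` instance on its letters (sequel).

## References
* [Kudla1994] S. S. Kudla, *Splitting metaplectic covers of dual reductive pairs*, Israel J. Math. 87 (1994), §2, §3 Thm. 3.1.
* [HarrisKudlaSweet1996] M. Harris, S. Kudla, W. J. Sweet, J. Amer. Math. Soc. 9 (1996), §1 (1.9)–(1.11), (1.15).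
* [MoeglinVignerasWaldspurger1987] C. Mœglin, M.-F. Vignéras, J.-L. Waldspurger, LNM 1291 (1987), Chap. 1 I.17, Chap. 2 II.1, II.6.
* [PlatonovRapinchuk1994] V. Platonov, A. Rapinchuk, *Algebraic Groups and Number Theory* (1994), §2.3.
* [Weil1964] A. Weil, *Sur certains groupes d'opérateurs unitaires*, Acta Math. 111 (1964), n° 32.
-/

set_option autoImplicit false
set_option linter.dupNamespace false -- the mandated namespace repeats `HodgeConjecture.HodgeConjecture`

noncomputable section

open scoped Matrix
open NumberField IsDedekindDomain Matrix
open Literature.NumberTheory.Automorphic Literature.NumberTheory.Automorphic.UnitaryGroup Literature.NumberTheory.Weil1964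
open Literature.NumberTheory.GelbartRogawski1991 Literature.NumberTheory.GelbartRogawski1991.AdaptedBlocks
open Literature.NumberTheory.GelbartRogawski1991.UnitaryDualPair.LocalSplitting
open Summit.HodgeConjecture.HodgeConjecture.Cruxes.HLiu418.K2LiuLocalSWSimilitudeAlgebra
open Summit.HodgeConjecture.HodgeConjecture.Cruxes.HLiu418.K2LiuLocalSWRamifiedRelativeSign (blkB_matA_localCongr_dA blkD_matA_localCongr_dA)
open Summit.HodgeConjecture.HodgeConjecture.Cruxes.HLiu418.K2LiuSiegelDeltaLeviUnipotent
open Summit.HodgeConjecture.HodgeConjecture.Cruxes.HLiu418.K2LiuSkewPairingNondegeneracy (smul_skew)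

namespace Summit.HodgeConjecture.HodgeConjecture.Cruxes.HLiu418.K2LiuLocalSWRamifiedLeviRowInvariance

variable (F : Type) [Field F] [NumberField F] (E : Type) [Field E] [NumberField E] [Algebra F E]
  (c : E ≃ₐ[F] E) (v : HeightOneSpectrum (𝓞 F)) (n : ℕ) {T₀ : Matrix (Fin n) (Fin n) F}
  {JD : Matrix (Fin (n + n)) (Fin (n + n)) E} (hJD : JD = (gramD F n T₀).map (algebraMap F E))
  (a : Fˣ) {D₀ : GL (Fin (n + n)) F}
  (hD₀ : (D₀ : Matrix (Fin (n + n)) (Fin (n + n)) F) =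
    Matrix.reindex (e₂ n) (e₂ n) (cayR F (Fin n) * Matrix.fromBlocks 1 0 0 ((a : F) • (1 : Matrix (Fin n) (Fin n) F)) * cayRinv F (Fin n)))
  {DA : GL (Fin (n + n)) E} (hDA : DA = Matrix.GeneralLinearGroup.map (algebraMap F E) D₀)
  {b : E} (hb : b ≠ 0) (hDAJ : formCongr (c : E →+* E) DA (b • JD) = JD)

/-! ## §1 The adapted blocks `B`, `D` and the unipotent coordinates under `Ad(d_a)` -/

/-- the unit relation `a_v⁻¹ · a_v = 1` in `E ⊗ F_v`. [folklore] -/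
theorem toLocalRing_inv_mul : toLocalRing E v (((a⁻¹ : Fˣ) : F) : v.adicCompletion F) * toLocalRing E v ((a : F) : v.adicCompletion F) = 1 := by
  rw [toLocalRing_coe, toLocalRing_coe, ← map_mul, ← map_mul, Units.inv_mul, map_one, map_one]

/-- the unit relation `a_v · a_v⁻¹ = 1` in `E ⊗ F_v`. [folklore] -/
theorem toLocalRing_mul_inv : toLocalRing E v ((a : F) : v.adicCompletion F) * toLocalRing E v (((a⁻¹ : Fˣ) : F) : v.adicCompletion F) = 1 := by
  rw [mul_comm, toLocalRing_inv_mul F E v a]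

include hD₀ hDA in
/-- **the unipotent coordinate `t = A⁻¹B` scales by the unit: `t(Ad_{d_a} p) = a_v⁻¹ · t(p)`**. [cite: Kudla1994, §3] [cite: Weil1964, n° 32] -/
theorem inv_blkA_mul_blkB_localCongr_dA (p : UnitaryGroup.localPi E c (n + n) JD v) :
    (blkA (matA F E c v n (localCongr E c DA hb hDAJ v p)))⁻¹ * blkB (matA F E c v n (localCongr E c DA hb hDAJ v p)) =
      (toLocalRing E v (((a⁻¹ : Fˣ) : F) : v.adicCompletion F)) • ((blkA (matA F E c v n p))⁻¹ * blkB (matA F E c v n p)) := by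
  rw [blkA_matA_localCongr_dA F E c v n a hD₀ hDA hb hDAJ, blkB_matA_localCongr_dA F E c v n a hD₀ hDA hb hDAJ, Matrix.mul_smul]

include hD₀ hDA in
/-- the other unipotent coordinate `B D⁻¹` scales the same way: `(B D⁻¹)(Ad_{d_a} p) = a_v⁻¹ · (B D⁻¹)(p)`. [cite: Kudla1994, §3] [cite: Weil1964, n° 32] -/
theorem blkB_mul_inv_blkD_localCongr_dA (p : UnitaryGroup.localPi E c (n + n) JD v) :
    blkB (matA F E c v n (localCongr E c DA hb hDAJ v p)) * (blkD (matA F E c v n (localCongr E c DA hb hDAJ v p)))⁻¹ =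
      (toLocalRing E v (((a⁻¹ : Fˣ) : F) : v.adicCompletion F)) • (blkB (matA F E c v n p) * (blkD (matA F E c v n p))⁻¹) := by
  rw [blkD_matA_localCongr_dA F E c v n a hD₀ hDA hb hDAJ, blkB_matA_localCongr_dA F E c v n a hD₀ hDA hb hDAJ, Matrix.smul_mul]

/-! ## §2 `Ad(d_a)` fixes the Levi-type elements -/

include hD₀ hDA in
/-- **`Ad(d_a) m = m` FOR `m` OF LEVI TYPE** (`B(m) = 0 = C(m)`): `adapt (matA (Ad m)) = [[A, a_v⁻¹·0], [a_v·0, D]] = adapt (matA m)` and `matA` is injective.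
[cite: Kudla1994, §3] [cite: HarrisKudlaSweet1996, §1 (1.11)] -/
theorem localCongr_dA_eq_self_of_blkB_eq_zero (m : UnitaryGroup.localPi E c (n + n) JD v)
    (hB : blkB (matA F E c v n m) = 0) (hC : blkC (matA F E c v n m) = 0) : localCongr E c DA hb hDAJ v m = m := by
  refine matA_injective F E c v n (eq_of_adapt_eq ?_)
  rw [adapt_matA_localCongr_dA F E c v n a hD₀ hDA hb hDAJ m, adapt_eq (matA F E c v n m), hB, hC, smul_zero, smul_zero]

/-! ## §3 `Ad(d_a)` on the unipotent elements `n(t)` -/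

include hD₀ hDA in
/-- **`Ad(d_a) n(t) = n(a_v⁻¹ · t)`**: `adapt (matA (Ad n(t))) = [[1, a_v⁻¹ t], [a_v·0, 1]]`. [cite: Kudla1994, §3] [cite: MoeglinVignerasWaldspurger1987, Chap. 2 II.1] -/
theorem localCongr_dA_nElem {t : Matrix (Fin n) (Fin n) (LocalRing E v)} (ht : (t.map (conjLocal E c v))ᵀ * gramS F E v n T₀ + gramS F E v n T₀ * t = 0) :
    localCongr E c DA hb hDAJ v (nElem F E c v n hJD t ht) =
      nElem F E c v n hJD (toLocalRing E v (((a⁻¹ : Fˣ) : F) : v.adicCompletion F) • t)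
        (smul_skew F E c v (((a⁻¹ : Fˣ) : F) : v.adicCompletion F) ht) := by
  refine matA_injective F E c v n (eq_of_adapt_eq ?_)
  have hn := adapt_matA_nElem F E c v n hJD t ht
  rw [adapt_eq] at hn
  obtain ⟨hA, hB, hC, hD⟩ := Matrix.fromBlocks_inj.1 hn
  rw [adapt_matA_localCongr_dA F E c v n a hD₀ hDA hb hDAJ, adapt_matA_nElem, hA, hB, hC, hD, smul_zero]

/-! ## §4 `Ad(d_a)` on `P_Δ = M_Δ · N_Δ` -/

include hD₀ hDA in
/-- **`Ad(d_a)(m · n(t)) = m · n(a_v⁻¹·t)`** for `m` of Levi type. [cite: Kudla1994, §3] [cite: HarrisKudlaSweet1996, §1 (1.11)] -/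
theorem localCongr_dA_levi_mul_nElem (m : UnitaryGroup.localPi E c (n + n) JD v)
    (hB : blkB (matA F E c v n m) = 0) (hC : blkC (matA F E c v n m) = 0)
    {t : Matrix (Fin n) (Fin n) (LocalRing E v)} (ht : (t.map (conjLocal E c v))ᵀ * gramS F E v n T₀ + gramS F E v n T₀ * t = 0) :
    localCongr E c DA hb hDAJ v (m * nElem F E c v n hJD t ht) =
      m * nElem F E c v n hJD (toLocalRing E v (((a⁻¹ : Fˣ) : F) : v.adicCompletion F) • t)
        (smul_skew F E c v (((a⁻¹ : Fˣ) : F) : v.adicCompletion F) ht) := by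
  rw [map_mul, localCongr_dA_eq_self_of_blkB_eq_zero F E c v n a hD₀ hDA hb hDAJ m hB hC, localCongr_dA_nElem F E c v n hJD a hD₀ hDA hb hDAJ ht]

include hD₀ hDA in
/-- **`Ad(d_a)(n(t) · m) = n(a_v⁻¹·t) · m`** for `m` of Levi type (the mirror order). [cite: Kudla1994, §3] [cite: HarrisKudlaSweet1996, §1 (1.11)] -/
theorem localCongr_dA_nElem_mul_levi (m : UnitaryGroup.localPi E c (n + n) JD v)
    (hB : blkB (matA F E c v n m) = 0) (hC : blkC (matA F E c v n m) = 0)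
    {t : Matrix (Fin n) (Fin n) (LocalRing E v)} (ht : (t.map (conjLocal E c v))ᵀ * gramS F E v n T₀ + gramS F E v n T₀ * t = 0) :
    localCongr E c DA hb hDAJ v (nElem F E c v n hJD t ht * m) =
      nElem F E c v n hJD (toLocalRing E v (((a⁻¹ : Fˣ) : F) : v.adicCompletion F) • t)
        (smul_skew F E c v (((a⁻¹ : Fˣ) : F) : v.adicCompletion F) ht) * m := by
  rw [map_mul, localCongr_dA_eq_self_of_blkB_eq_zero F E c v n a hD₀ hDA hb hDAJ m hB hC, localCongr_dA_nElem F E c v n hJD a hD₀ hDA hb hDAJ ht]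

/-! ## §5 The `hd₁` row from unit-scaling invariance in the unipotent letter; Levi letters are invariant -/

include hD₀ hDA in
/-- **LEVI LETTERS ARE `Ad(d_a)`-INVARIANT**: any function of the `A`- and `D`-blocks alone takes the same value at `Ad_{d_a} x` and `x` (for every `x`, in particular on
`P_Δ`) — the Levi letters of the (C3) factorisation row (`c(x) = χ_v(det_Δ x)|det|^s`, the radii `ρ_x, ρ′_x` read on the rows of `D`, the balls `B_x, U_x, C_x`).
[cite: Kudla1994, §3 Thm. 3.1] [cite: HarrisKudlaSweet1996, §1 (1.15)] -/
theorem levi_letters_localCongr_dA {X : Type*} (G : Matrix (Fin n) (Fin n) (LocalRing E v) → Matrix (Fin n) (Fin n) (LocalRing E v) → X)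
    (x : UnitaryGroup.localPi E c (n + n) JD v) :
    G (blkA (matA F E c v n (localCongr E c DA hb hDAJ v x))) (blkD (matA F E c v n (localCongr E c DA hb hDAJ v x))) =
      G (blkA (matA F E c v n x)) (blkD (matA F E c v n x)) := by
  rw [blkA_matA_localCongr_dA F E c v n a hD₀ hDA hb hDAJ, blkD_matA_localCongr_dA F E c v n a hD₀ hDA hb hDAJ]

section Siegel

variable [Algebra.IsQuadraticExtension F E]

include hD₀ hDA in
/-- **THE DILATION ROW FROM UNIT-SCALING INVARIANCE**: if for every Levi-type `m ∈ P_Δ` (`B(m) = 0`) and every skew `t`, `F₀(w₁ · (m · n(a_v⁻¹·t))) = F₀(w₁ · (m · n(t)))`,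
then `F₀(w₁ · Ad_{d_a} x) = F₀(w₁ · x)` for every `x ∈ P_Δ` — `x = m_x · n(A⁻¹B)` (★ (R-g) `exists_levi_mul_nElem`) and §4.  This is the `hd₁` row of
★ `K2LiuLocalSWSpanningRamified` ∕ the conclusion of the `hmid` binder of ★ `…OfMpMoverMiddleRow`, for ANY function `F₀` and flip `w₁`.
[cite: Kudla1994, §3 Thm. 3.1] [cite: HarrisKudlaSweet1996, §1 (1.11), (1.15)] [cite: MoeglinVignerasWaldspurger1987, Chap. 2 II.1] -/
theorem flip_mul_localCongr_dA_eq_of_unipScaling {δ : E} (hcδ : c δ = -δ) (hδ : δ ≠ 0) {d : F} (hd : δ * δ = algebraMap F E d) (hT₀ : T₀.IsSymm)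
    {X : Type*} (F₀ : UnitaryGroup.localPi E c (n + n) JD v → X) (w₁ : UnitaryGroup.localPi E c (n + n) JD v)
    (h : ∀ m : UnitaryGroup.localPi E c (n + n) JD v, IsSiegelDelta F E c hcδ hδ hd v n hT₀ hJD m → blkB (matA F E c v n m) = 0 →
      ∀ (t : Matrix (Fin n) (Fin n) (LocalRing E v)) (ht : (t.map (conjLocal E c v))ᵀ * gramS F E v n T₀ + gramS F E v n T₀ * t = 0),
        F₀ (w₁ * (m * nElem F E c v n hJD (toLocalRing E v (((a⁻¹ : Fˣ) : F) : v.adicCompletion F) • t)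
          (smul_skew F E c v (((a⁻¹ : Fˣ) : F) : v.adicCompletion F) ht))) = F₀ (w₁ * (m * nElem F E c v n hJD t ht))) :
    ∀ x, IsSiegelDelta F E c hcδ hδ hd v n hT₀ hJD x → F₀ (w₁ * localCongr E c DA hb hDAJ v x) = F₀ (w₁ * x) := by
  intro x hx
  obtain ⟨m, hm, hB, -, -, hxm⟩ := exists_levi_mul_nElem F E c hcδ hδ hd v n hT₀ hJD x hx
  have hC : blkC (matA F E c v n m) = 0 := (isSiegelDelta_iff_blkC_eq_zero F E c hcδ hδ hd v n hT₀ hJD m).1 hm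
  -- rewrite the occurrences of `x` through its Levi–unipotent decomposition
  have e1 : F₀ (w₁ * localCongr E c DA hb hDAJ v x) = F₀ (w₁ * localCongr E c DA hb hDAJ v (m * nElem F E c v n hJD _
      (skew_inv_blkA_mul_blkB F E c hcδ hδ hd v n hT₀ hJD x hx))) := by rw [← hxm]
  have e2 : F₀ (w₁ * x) = F₀ (w₁ * (m * nElem F E c v n hJD _ (skew_inv_blkA_mul_blkB F E c hcδ hδ hd v n hT₀ hJD x hx))) := by rw [← hxm]
  rw [e1, e2, localCongr_dA_levi_mul_nElem F E c v n hJD a hD₀ hDA hb hDAJ m hB hC]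
  exact h m hm hB _ _

include hD₀ hDA in
/-- **`P_Δ`-membership and the Levi decomposition of `Ad_{d_a} x`**: for `x ∈ P_Δ` with `x = m · n(A⁻¹B)`, `Ad_{d_a} x ∈ P_Δ`, `Ad_{d_a} x = m · n(a_v⁻¹ A⁻¹B)`, with
the SAME Levi part and the same `A`-, `D`-blocks. [cite: Kudla1994, §3] [cite: HarrisKudlaSweet1996, §1 (1.11)] -/
theorem exists_levi_mul_nElem_localCongr_dA {δ : E} (hcδ : c δ = -δ) (hδ : δ ≠ 0) {d : F} (hd : δ * δ = algebraMap F E d) (hT₀ : T₀.IsSymm)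
    (x : UnitaryGroup.localPi E c (n + n) JD v) (hx : IsSiegelDelta F E c hcδ hδ hd v n hT₀ hJD x) :
    ∃ m : UnitaryGroup.localPi E c (n + n) JD v,
      IsSiegelDelta F E c hcδ hδ hd v n hT₀ hJD m ∧ blkB (matA F E c v n m) = 0 ∧
        blkA (matA F E c v n m) = blkA (matA F E c v n x) ∧ blkD (matA F E c v n m) = blkD (matA F E c v n x) ∧
          x = m * nElem F E c v n hJD ((blkA (matA F E c v n x))⁻¹ * blkB (matA F E c v n x)) (skew_inv_blkA_mul_blkB F E c hcδ hδ hd v n hT₀ hJD x hx) ∧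
          IsSiegelDelta F E c hcδ hδ hd v n hT₀ hJD (localCongr E c DA hb hDAJ v x) ∧
          localCongr E c DA hb hDAJ v x = m * nElem F E c v n hJD
            (toLocalRing E v (((a⁻¹ : Fˣ) : F) : v.adicCompletion F) • ((blkA (matA F E c v n x))⁻¹ * blkB (matA F E c v n x)))
            (smul_skew F E c v (((a⁻¹ : Fˣ) : F) : v.adicCompletion F) (skew_inv_blkA_mul_blkB F E c hcδ hδ hd v n hT₀ hJD x hx)) := by
  obtain ⟨m, hm, hB, hA, hD, hxm⟩ := exists_levi_mul_nElem F E c hcδ hδ hd v n hT₀ hJD x hx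
  have hC : blkC (matA F E c v n m) = 0 := (isSiegelDelta_iff_blkC_eq_zero F E c hcδ hδ hd v n hT₀ hJD m).1 hm
  refine ⟨m, hm, hB, hA, hD, hxm, (isSiegelDelta_localCongr_dA_iff F E c v n hJD a hD₀ hDA hb hDAJ hcδ hδ hd hT₀ x).2 hx, ?_⟩
  have e : localCongr E c DA hb hDAJ v x = localCongr E c DA hb hDAJ v (m * nElem F E c v n hJD _
      (skew_inv_blkA_mul_blkB F E c hcδ hδ hd v n hT₀ hJD x hx)) := by rw [← hxm]
  rw [e, localCongr_dA_levi_mul_nElem F E c v n hJD a hD₀ hDA hb hDAJ m hB hC]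

end Siegel

/-! ## §6 «trivial on a ball» is insensitive to a unit rescaling of the argument -/

/-- **UNIT RESCALING ON A BALL**: for a valuation `w` and `u` with `w u = 1`, a predicate holds at `u·z` for all `z` in the ball `w z ≤ r` iff it holds on the ball —
`z ↦ u·z` permutes the ball (the unipotent letter of the (C3) row enters `g` only through «`Ψ_x` is trivial on a ball», and `Ψ_{Ad_{d_a} x} = Ψ_x(a_v⁻¹ ·)` with
`|a|_{w₀} = 1`). [cite: MoeglinVignerasWaldspurger1987, Chap. 2 II.1] [cite: Weil1964, n° 32] -/
theorem forall_le_imp_comp_mul_iff {K : Type*} [Field K] {Γ₀ : Type*} [LinearOrderedCommGroupWithZero Γ₀] (w : Valuation K Γ₀)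
    {u : K} (hu : w u = 1) (P : K → Prop) (r : Γ₀) :
    (∀ z, w z ≤ r → P (u * z)) ↔ (∀ z, w z ≤ r → P z) := by
  have hu0 : u ≠ 0 := fun h => by rw [h, map_zero] at hu; exact zero_ne_one hu
  constructor
  · intro h z hz
    have h' := h (u⁻¹ * z) (by rw [map_mul, map_inv₀, hu, inv_one, one_mul]; exact hz)
    rwa [← mul_assoc, mul_inv_cancel₀ hu0, one_mul] at h'
  · intro h z hz
    exact h (u * z) (by rw [map_mul, hu, one_mul]; exact hz)

/-- the same for a predicate on the ball of a product of radii, in the letters of ★ (M2b) `factorisation_of_middleProfile_balls` (`Q_x := ∀ z, v z ≤ ρ_x·ρ′_x → Ψ_x z = 1`).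
[cite: MoeglinVignerasWaldspurger1987, Chap. 2 II.1] [cite: Kudla1994, §3 Thm. 3.1] -/
theorem forall_le_imp_apply_mul_eq_one_iff {K : Type*} [Field K] {Γ₀ : Type*} [LinearOrderedCommGroupWithZero Γ₀] (w : Valuation K Γ₀)
    {u : K} (hu : w u = 1) {M : Type*} (Ψ : K → M) (one : M) (ρ ρ' : Γ₀) :
    (∀ z, w z ≤ ρ * ρ' → Ψ (u * z) = one) ↔ (∀ z, w z ≤ ρ * ρ' → Ψ z = one) :=
  forall_le_imp_comp_mul_iff w hu (fun z => Ψ z = one) (ρ * ρ')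

end Summit.HodgeConjecture.HodgeConjecture.Cruxes.HLiu418.K2LiuLocalSWRamifiedLeviRowInvariance

end
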